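import Summits.Schanuel.Schanuel.Theorems.DiophantineDichotomyApproximationPropertyRaceDefs
import HarnessLib

/-!
# The race form of `ApproximationProperty` suffices for the route (crux stmt-Schanuel-6117)

Route `DiophantineDichotomy` (sub-problem `Schanuel/Schanuel`), crux
`Summit.Schanuel.Schanuel.Theses.DiophantineDichotomy.ApproximationProperty`; vocabulary
`…ApproximationPropertyRaceDefs.lean` (`ApproximationPropertyRace`, with the bookkeeping
`apRace_of_approximationProperty : ApproximationProperty → ApproximationPropertyRace`). One registered
sub-goal of the crux item, PROOF ONLY (no definitions, no named facts, no `sorry`):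

* `schanuel_of_apRace : ApproximationPropertyRace → KhovanskiiApproxTypeEv → KhovanskiiReduction →
  Schanuel` — the route's deciding theorem `closes` re-run on the race form: its proof fixes ONE
  `Δ` (any `Δ ≥ c` with `cC·c^{tA} ≤ Δ^{1−tA}`, an eventually-true condition, so a COFINAL family of
  `Δ` is enough) and ONE large `Y` (beyond `Δ`, the race threshold `Y₁` and the Northcott separation
  threshold of the finite exceptional set — again a cofinal family of `Y` is enough), and never uses
  `log H ≤ cYΔ^{t-1}`. Verbatim the argument of `closes` (Hermite–Lindemann for `n = 1`; race
  compactness for `n ≥ 2`), with the two `Filter.atTop` witnesses replaced by thresholds fed to the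
  race form.

So the crux as filed (`ApproximationProperty`, all scales, height budget; for `t ≥ 3` Philippon's
open AP2 / AP1 conjecture — KERNEL-c5…c10) is STRONGER than what decides the route; the planner may
restate crux 3 as `ApproximationPropertyRace` (KERNEL-c10.md §5). Sources: the route file
(`closes`, planner-rbadge 2026-08-16); NesterenkoPhilippon2001 Ch. 4 §4; LaurentRoy1999.
-/

noncomputable section

-- `Summit.Schanuel.Schanuel.…` is the mandated summit/sub-problem namespace (single-conjunct summit), hence:
set_option linter.dupNamespace false

namespace Summit.Schanuel.Schanuel.Cruxes.ApproximationProperty.Race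

open Summit.Schanuel.Schanuel.Theses.DiophantineDichotomy

/-- **Registered sub-goal `schanuel_of_apRace`** — the route's deciding theorem from the RACE FORM of
crux 3: `ApproximationPropertyRace → KhovanskiiApproxTypeEv → KhovanskiiReduction → Schanuel`.
Proof = `closes` (route file) with the scale `Δ` and the height `Y` taken from the cofinal families
the race form provides (thresholds from `Filter.eventually_atTop`), the unused height budget gone.
`n = 1`: Hermite–Lindemann (`transcendental_exp_holds`); `n ≥ 2`: race compactness — at the fixed
`Δ` the degree cap `D₀ = ⌊(cΔ)^{n-1}⌋` makes the points all of whose coordinates are roots of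
non-zero integer polynomials of degree `≤ D₀` and height `≤ max_{d ≤ D₀} H₀(d)` a FINITE set missing
`θ = (s, e^s)`, so a datum at a large `Y` has `H > H⋆`, the eventual measure applies, and
`Δ log H + dY ≤ cC(dᵃ log H + dᵇ)` contradicts `cC dᵃ ≤ Δ`, `cC dᵇ < Y ≤ dY`. [folklore] -/
theorem schanuel_of_apRace :
    ApproximationPropertyRace → KhovanskiiApproxTypeEv → KhovanskiiReduction → _root_.Schanuel := by
  intro hAP hEv hRed
  refine hRed ?_
  intro n s hs hg
  have HL := @Literature.NumberTheory.Transcendental.transcendental_exp_holds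
  have one_le_of_transc : ∀ {L : IntermediateField ℚ ℂ} {w : ℂ}, w ∈ L → Transcendental ℚ w →
      (1 : Cardinal) ≤ Algebra.trdeg ℚ L := by
    intro L w hw ht
    haveI : Algebra.Transcendental ℚ L :=
      ⟨⟨⟨w, hw⟩, fun h => ht (IntermediateField.isAlgebraic_iff.mp h)⟩⟩
    exact Cardinal.one_le_iff_pos.mpr (_root_.trdeg_pos ℚ L)
  have one_le_of_root : ∀ {P : Polynomial ℤ} {d : ℕ} {z : ℂ}, P ≠ 0 → P.natDegree ≤ d →
      Polynomial.aeval z P = 0 → 1 ≤ d := by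
    intro P d z hP hdeg hz
    by_contra hd
    have hd0 : P.natDegree = 0 := by omega
    rw [Polynomial.eq_C_of_natDegree_eq_zero hd0, Polynomial.aeval_C, eq_intCast,
      Int.cast_eq_zero] at hz
    apply hP
    rw [Polynomial.eq_C_of_natDegree_eq_zero hd0, hz, map_zero]
  have algQ : ∀ {z : ℂ} {P : Polynomial ℤ}, P ≠ 0 → Polynomial.aeval z P = 0 → IsAlgebraic ℚ z :=
    fun hP hz => IsAlgebraic.extendScalars (R := ℤ) (S := ℚ) (algebraMap ℤ ℚ).injective_int ⟨_, hP, hz⟩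
  rcases Nat.lt_or_ge n 2 with hn | hn
  · interval_cases n
    · simp
    · -- `n = 1`: Hermite–Lindemann
      rw [Nat.cast_one]
      by_cases halg : IsAlgebraic ℚ (s 0)
      · exact one_le_of_transc (IntermediateField.subset_adjoin ℚ _ (Or.inr ⟨0, rfl⟩))
          (HL halg (hs.ne_zero 0))
      · exact one_le_of_transc (IntermediateField.subset_adjoin ℚ _ (Or.inl ⟨0, rfl⟩)) halg
  · -- `n ≥ 2`: the EVENTUAL exponent race (race compactness: fix `Δ`, let `Y → ∞`)
    by_contra hlt
    rw [not_le] at hlt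
    have key : ∀ S : Set ℂ, S = Set.range s ∪ Set.range (Complex.exp ∘ s) →
        Algebra.trdeg ℚ ↥(IntermediateField.adjoin ℚ S) ≤ ((n - 1 : ℕ) : Cardinal) := by
      rintro S rfl
      have h1 : (n : Cardinal) = Order.succ ((n - 1 : ℕ) : Cardinal) := by
        rw [Cardinal.succ_natCast]
        exact_mod_cast (by omega : n = n - 1 + 1)
      rw [h1] at hlt
      exact Order.lt_succ_iff.mp hlt
    obtain ⟨c, hc1, hAP'⟩ := hAP (Fin n ⊕ Fin n) (Sum.elim s (Complex.exp ∘ s)) (n - 1)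
      (by omega) (key _ (Set.Sum.elim_range _ _))
    obtain ⟨a, b, C, ha, hC, hEv'⟩ := hEv n s hn hs hg
    choose H₀ hH₀ using hEv'
    have hcpos : (0 : ℝ) < c := lt_of_lt_of_le one_pos hc1
    -- THE RACE (pure real analysis): a THRESHOLD for the scale `Δ`, then every large `Y`
    have race : ∀ t : ℕ, 1 ≤ t → a < 1 / (t : ℝ) → ∃ Δ₀ : ℝ, ∀ Δ : ℝ, Δ₀ ≤ Δ → c ≤ Δ →
        ∃ Y₁ : ℝ, 0 ≤ Y₁ ∧
        ∀ Y : ℝ, Y₁ ≤ Y → ∀ d H : ℕ, 1 ≤ d → 1 ≤ H → (d : ℝ) ≤ (c * Δ) ^ t →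
          c * (C * ((d : ℝ) ^ a * Real.log H + (d : ℝ) ^ b)) < Real.log H * Δ + d * Y := by
      intro t ht hat
      set A : ℝ := max a 0
      set B : ℝ := max b 0
      have htpos : (0 : ℝ) < t := by exact_mod_cast ht
      have hA0 : 0 ≤ A := le_max_right _ _
      have hB0 : 0 ≤ B := le_max_right _ _
      have hAt : (t : ℝ) * A < 1 := by
        have hA' : A < 1 / (t : ℝ) := max_lt hat (by positivity)
        calc (t : ℝ) * A < t * (1 / t) := mul_lt_mul_of_pos_left hA' htpos
          _ = 1 := mul_one_div_cancel htpos.ne'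
      set e : ℝ := 1 - t * A with he
      have hepos : 0 < e := by rw [he]; linarith
      set M : ℝ := c * C * c ^ ((t : ℝ) * A) with hM
      have hev : ∀ᶠ Δ in Filter.atTop, M ≤ Δ ^ e :=
        (tendsto_rpow_atTop hepos).eventually_ge_atTop M
      obtain ⟨Δ₀, hΔ₀⟩ := Filter.eventually_atTop.mp hev
      refine ⟨Δ₀, fun Δ hΔ₀Δ hcΔ => ?_⟩
      have hMΔ : M ≤ Δ ^ e := hΔ₀ Δ hΔ₀Δ
      have hΔpos : 0 < Δ := lt_of_lt_of_le hcpos hcΔ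
      have hcΔpos : 0 < c * Δ := mul_pos hcpos hΔpos
      have hcC : 0 ≤ c * C := by positivity
      refine ⟨c * C * (c * Δ) ^ ((t : ℝ) * B) + 1, by positivity,
        fun Y hY₁Y d H hd hH hdle => ?_⟩
      have hd1 : (1 : ℝ) ≤ d := by exact_mod_cast hd
      have hd0 : (0 : ℝ) ≤ d := by positivity
      have hL : 0 ≤ Real.log H := Real.log_nonneg (by exact_mod_cast hH)
      have hda : (d : ℝ) ^ a ≤ (d : ℝ) ^ A :=
        Real.rpow_le_rpow_of_exponent_le hd1 (le_max_left _ _)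
      have hdb : (d : ℝ) ^ b ≤ (d : ℝ) ^ B :=
        Real.rpow_le_rpow_of_exponent_le hd1 (le_max_left _ _)
      have hpow : ∀ E : ℝ, 0 ≤ E → (d : ℝ) ^ E ≤ (c * Δ) ^ ((t : ℝ) * E) := fun E hE => by
        calc (d : ℝ) ^ E ≤ ((c * Δ) ^ t) ^ E := Real.rpow_le_rpow hd0 hdle hE
          _ = (c * Δ) ^ ((t : ℝ) * E) := by
            rw [← Real.rpow_natCast, ← Real.rpow_mul hcΔpos.le]
      have hI : c * C * (d : ℝ) ^ A ≤ Δ := by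
        calc c * C * (d : ℝ) ^ A ≤ c * C * (c * Δ) ^ ((t : ℝ) * A) :=
              mul_le_mul_of_nonneg_left (hpow A hA0) hcC
          _ = M * Δ ^ ((t : ℝ) * A) := by
              rw [Real.mul_rpow hcpos.le hΔpos.le, hM]; ring
          _ ≤ Δ ^ e * Δ ^ ((t : ℝ) * A) :=
              mul_le_mul_of_nonneg_right hMΔ (Real.rpow_nonneg hΔpos.le _)
          _ = Δ := by
              rw [← Real.rpow_add hΔpos, he, sub_add_cancel, Real.rpow_one]
      have hI' : c * C * (d : ℝ) ^ A * Real.log H ≤ Δ * Real.log H :=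
        mul_le_mul_of_nonneg_right hI hL
      have hY0 : 0 ≤ Y := le_trans (by positivity) hY₁Y
      have hII : c * C * (d : ℝ) ^ B < (d : ℝ) * Y := by
        calc c * C * (d : ℝ) ^ B ≤ c * C * (c * Δ) ^ ((t : ℝ) * B) :=
              mul_le_mul_of_nonneg_left (hpow B hB0) hcC
          _ < c * C * (c * Δ) ^ ((t : ℝ) * B) + 1 := lt_add_one _
          _ ≤ Y := hY₁Y
          _ ≤ (d : ℝ) * Y := le_mul_of_one_le_left hY0 hd1
      have h1 : c * C * ((d : ℝ) ^ a * Real.log H) ≤ c * C * ((d : ℝ) ^ A * Real.log H) :=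
        mul_le_mul_of_nonneg_left (mul_le_mul_of_nonneg_right hda hL) hcC
      have h2 : c * C * (d : ℝ) ^ b ≤ c * C * (d : ℝ) ^ B := mul_le_mul_of_nonneg_left hdb hcC
      have hexp : c * (C * ((d : ℝ) ^ a * Real.log H + (d : ℝ) ^ b)) =
          c * C * ((d : ℝ) ^ a * Real.log H) + c * C * (d : ℝ) ^ b := by ring
      rw [hexp]
      linarith [h1, h2, hI', hII]
    have ha' : a < 1 / ((n - 1 : ℕ) : ℝ) := by
      rw [Nat.cast_sub (by omega), Nat.cast_one]; exact ha
    obtain ⟨Δ₀, hrace₀⟩ := race (n - 1) (by omega) ha'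
    -- the race form supplies ONE scale `Δ ≥ Δ₀`, `Δ ≥ c`, with data at cofinally many `Y`
    obtain ⟨Δ, hΔ₀Δ, hcΔ, hAPΔ⟩ := hAP' Δ₀
    obtain ⟨Y₁, hY₁0, hrace⟩ := hrace₀ Δ hΔ₀Δ hcΔ
    have hΔpos : 0 < Δ := lt_of_lt_of_le hcpos hcΔ
    -- RACE COMPACTNESS: the degree cap `D₀` and the uniform height threshold `H⋆`
    obtain ⟨D₀, hD₀⟩ : ∃ D₀ : ℕ, ∀ d : ℕ, (d : ℝ) ≤ (c * Δ) ^ (n - 1) → d ≤ D₀ :=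
      ⟨⌊(c * Δ) ^ (n - 1)⌋₊, fun d hd => Nat.le_floor hd⟩
    obtain ⟨Hstar, hHstar⟩ : ∃ Hstar : ℕ, ∀ d : ℕ, d ≤ D₀ → H₀ d ≤ Hstar :=
      ⟨(Finset.range (D₀ + 1)).sup H₀, fun d hd =>
        Finset.le_sup (f := H₀) (Finset.mem_range.mpr (Nat.lt_succ_of_le hd))⟩
    obtain ⟨E, hE⟩ : ∃ E : Set (Fin n ⊕ Fin n → ℂ), ∀ γ, γ ∈ E ↔ ∀ i, ∃ P : Polynomial ℤ, P ≠ 0 ∧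
        P.natDegree ≤ D₀ ∧ (∀ k, |P.coeff k| ≤ (Hstar : ℤ)) ∧ Polynomial.aeval (γ i) P = 0 :=
      ⟨{γ | ∀ i, ∃ P : Polynomial ℤ, P ≠ 0 ∧ P.natDegree ≤ D₀ ∧ (∀ k, |P.coeff k| ≤ (Hstar : ℤ)) ∧
          Polynomial.aeval (γ i) P = 0}, fun γ => Iff.rfl⟩
    have hinj : Function.Injective (algebraMap ℤ ℂ) := (algebraMap ℤ ℂ).injective_int
    have hEfin : E.Finite := by
      have hR := Polynomial.bUnion_roots_finite (algebraMap ℤ ℂ) D₀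
        (Set.finite_Icc (-(Hstar : ℤ)) (Hstar : ℤ))
      refine (Set.Finite.pi fun (_ : Fin n ⊕ Fin n) => hR).subset fun γ hγ => ?_
      rw [Set.mem_univ_pi]
      intro i
      obtain ⟨P, hP0, hdeg, hcoef, hroot⟩ := (hE γ).mp hγ i
      refine Set.mem_iUnion₂.mpr ⟨P, ⟨hdeg, fun k => Set.mem_Icc.mpr (abs_le.mp (hcoef k))⟩, ?_⟩
      rw [Finset.mem_coe, Multiset.mem_toFinset, Polynomial.mem_roots_map_of_injective hinj hP0,
        ← Polynomial.aeval_def]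
      exact hroot
    have hθE : Sum.elim s (Complex.exp ∘ s) ∉ E := by
      intro hθ
      obtain ⟨P, hP0, -, -, hPz⟩ := (hE _).mp hθ (Sum.inl ⟨0, by omega⟩)
      obtain ⟨Q, hQ0, -, -, hQz⟩ := (hE _).mp hθ (Sum.inr ⟨0, by omega⟩)
      exact HL (algQ hP0 hPz) (hs.ne_zero _) (algQ hQ0 hQz)
    have htend : Filter.Tendsto (fun Y : ℝ => Real.exp (-(Y / c))) Filter.atTop (nhds 0) :=
      Real.tendsto_exp_atBot.comp
        (Filter.tendsto_neg_atTop_atBot.comp (Filter.tendsto_id.atTop_div_const hcpos))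
    have hall : ∀ᶠ Y : ℝ in Filter.atTop, ∀ p ∈ E,
        Real.exp (-(Y / c)) < ‖p - Sum.elim s (Complex.exp ∘ s)‖ := by
      refine (hEfin.eventually_all).mpr fun p hp => htend.eventually (gt_mem_nhds ?_)
      rw [norm_pos_iff, sub_ne_zero]
      rintro rfl
      exact hθE hp
    -- a THRESHOLD `Y₂` for all three eventual conditions, then `Y ≥ Y₂` from the race form
    obtain ⟨Y₂, hY₂⟩ := Filter.eventually_atTop.mp
      ((Filter.eventually_ge_atTop Δ).and ((Filter.eventually_ge_atTop Y₁).and hall))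
    obtain ⟨Y, hY₂Y, γ, d, H, hfin, hpoly, hdcap, hdist⟩ := hAPΔ Y₂
    obtain ⟨hΔY, hY₁Y, hYsep⟩ := hY₂ Y hY₂Y
    obtain ⟨P₀, hP₀0, hP₀deg, -, hP₀z⟩ := hpoly (Sum.inl ⟨0, by omega⟩)
    have h1d : 1 ≤ d := one_le_of_root hP₀0 hP₀deg hP₀z
    have hY0 : 0 ≤ Y := le_trans hY₁0 hY₁Y
    have hdistY : ‖γ - Sum.elim s (Complex.exp ∘ s)‖ ≤ Real.exp (-(Y / c)) := by
      refine hdist.trans (Real.exp_le_exp.mpr ?_)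
      have hlogH : 0 ≤ Real.log H := Real.log_natCast_nonneg H
      have hYle : Y ≤ Real.log H * Δ + d * Y := by
        have hdY : Y ≤ (d : ℝ) * Y := le_mul_of_one_le_left hY0 (by exact_mod_cast h1d)
        nlinarith [mul_nonneg hlogH hΔpos.le]
      have := div_le_div_of_nonneg_right hYle hcpos.le
      linarith
    have hγE : γ ∉ E := fun hγ => absurd hdistY (not_le.mpr (hYsep γ hγ))
    have hHstar_lt : Hstar < H := by
      by_contra hH
      push Not at hH
      refine hγE ((hE γ).mpr fun i => ?_)
      obtain ⟨P, hP0, hPdeg, hPH, hPz⟩ := hpoly i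
      exact ⟨P, hP0, hPdeg.trans (hD₀ d hdcap), fun k => (hPH k).trans (by exact_mod_cast hH), hPz⟩
    have hlow := hH₀ d H γ ((hHstar d (hD₀ d hdcap)).trans hHstar_lt.le) hfin hpoly
    have h1H : 1 ≤ H := Nat.succ_le_of_lt (lt_of_le_of_lt (Nat.zero_le _) hHstar_lt)
    have hsand := neg_le_neg (Real.exp_le_exp.mp (hlow.trans hdist))
    rw [neg_neg, neg_neg, div_le_iff₀ hcpos] at hsand
    have hwin := hrace Y hY₁Y d H h1d h1H hdcap
    linarith

end Summit.Schanuel.Schanuel.Cruxes.ApproximationProperty.Race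

end
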